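import Mathlib
import Literature.Analysis.FluidPDE.NSFourierAPriori
import HarnessLib

/-!
# Route FrozenSignCascade · item `TightEnvelopeContinuation` — helper 1: frequency-space integrals

Helper file for statement item stmt-NavierStokesRegularity-10580 (`TightEnvelopeContinuation`,
support of route `FrozenSignCascade`); lands `--supports` that item.

The a-priori bound of the order-`4` Fourier weights of a Fourier-side mild solution by a *tight
critical envelope* (`sup_{‖ξ‖ ≥ R} ‖ξ‖²‖V(t,ξ)‖ ≤ ε`) plus the energy (next helper file) rests on
four elementary frequency-space integrals on `ℝ³`, proved here:

* `integral_annulus_inv_norm_sq_le` — `∫_{R ≤ ‖ζ‖ ≤ ρ} ‖ζ‖⁻² dζ ≤ 3|B₁| ρ` (`R > 0`);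
* `integral_tail_weight_le` — `∫_{‖η‖ ≥ r₀} (1+‖η‖)⁻⁴ dη ≤ 3|B₁| / r₀` (`r₀ > 0`);
  both by the polar formula `∫ f(‖x‖) dx = 3|B₁| ∫₀^∞ y² f(y) dy` (`integral_fun_norm_addHaar`);
* `norm_fconv_le_integral_norm_sq` — `|(v_j ⋆ v_k)(ξ)| ≤ ∫ ‖v‖²` (AM–GM and translation
  invariance), the energy-level bound of the convolution used at low frequencies;
* `norm_nonlin_le_of_fconv_le` — the symbol bound `‖N(v,w)(ξ)‖ ≤ 36π ‖ξ‖ X` from a bound `X` of the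
  nine convolutions (the constant of `FourierNS.norm_nonlin_le_mixed`, isolated).

References: P. G. Lemarié-Rieusset, *The Navier–Stokes problem in the 21st century* (2016), §8.5
(pseudo-measure / weighted sup-norm calculus); folklore otherwise.
-/

noncomputable section

set_option linter.dupNamespace false -- nested layout Summit.<S>.<Sub>, Sub = S (D-0017)

open MeasureTheory Set Metric Real
open Literature.Analysis.FluidPDE.FourierNS

namespace Summit.NavierStokesRegularity.NavierStokesRegularity.Theorems.TightEnvelope

/-! ### The polar formula on `ℝ³` -/

/-- `dim ℝ³ = 3`. -/
theorem finrank_euclideanSpace_fin_three : Module.finrank ℝ (EuclideanSpace ℝ (Fin 3)) = 3 := by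
  rw [finrank_euclideanSpace, Fintype.card_fin]

/-- **Polar coordinates on `ℝ³`** for real integrands: `∫ f(‖x‖) dx = 3 |B₁| ∫_{y>0} y² f(y) dy`
(`MeasureTheory.integral_fun_norm_addHaar` with `dim = 3`). -/
theorem integral_fun_norm_three (f : ℝ → ℝ) :
    ∫ x : EuclideanSpace ℝ (Fin 3), f ‖x‖ =
      3 * (volume (ball (0 : EuclideanSpace ℝ (Fin 3)) 1)).toReal *
        ∫ y in Ioi (0 : ℝ), y ^ 2 * f y := by
  have h := integral_fun_norm_addHaar (volume : Measure (EuclideanSpace ℝ (Fin 3))) f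
  rw [finrank_euclideanSpace_fin_three] at h
  have h2 : (fun y : ℝ => y ^ (3 - 1) • f y) = fun y => y ^ 2 * f y := by
    funext y; simp [smul_eq_mul]
  rw [h2] at h
  rw [h, nsmul_eq_mul, smul_eq_mul, measureReal_def]
  push_cast
  ring

/-- **The annulus integral of `‖ζ‖⁻²`**: for `0 < R` and `0 ≤ ρ`,
`∫ 1_{R ≤ ‖ζ‖ ≤ ρ} ‖ζ‖⁻² dζ ≤ 3|B₁| ρ` (polar coordinates: the radial integrand is `1_{[R,ρ]}`). -/
theorem integral_annulus_inv_norm_sq_le {R ρ : ℝ} (hR : 0 < R) (hρ : 0 ≤ ρ) :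
    ∫ ζ : EuclideanSpace ℝ (Fin 3),
        {ζ : EuclideanSpace ℝ (Fin 3) | R ≤ ‖ζ‖ ∧ ‖ζ‖ ≤ ρ}.indicator (fun ζ => (‖ζ‖ ^ 2)⁻¹) ζ ≤
      3 * (volume (ball (0 : EuclideanSpace ℝ (Fin 3)) 1)).toReal * ρ := by
  set f : ℝ → ℝ := (Icc R ρ).indicator fun y => (y ^ 2)⁻¹ with hf
  have hfun : (fun ζ : EuclideanSpace ℝ (Fin 3) =>
      {ζ : EuclideanSpace ℝ (Fin 3) | R ≤ ‖ζ‖ ∧ ‖ζ‖ ≤ ρ}.indicator (fun ζ => (‖ζ‖ ^ 2)⁻¹) ζ) =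
      fun ζ => f ‖ζ‖ := by
    funext ζ
    simp only [hf, indicator, mem_setOf_eq, mem_Icc]
  rw [hfun, integral_fun_norm_three f]
  have hvol : 0 ≤ 3 * (volume (ball (0 : EuclideanSpace ℝ (Fin 3)) 1)).toReal := by positivity
  refine mul_le_mul_of_nonneg_left ?_ hvol
  have hpt : ∀ y ∈ Ioi (0 : ℝ), y ^ 2 * f y = (Icc R ρ).indicator (fun _ => (1 : ℝ)) y := by
    intro y hy
    simp only [hf, indicator, mem_Icc]
    split_ifs with h
    · have hy0 : y ≠ 0 := ne_of_gt hy
      field_simp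
    · simp
  rw [setIntegral_congr_fun measurableSet_Ioi hpt, setIntegral_indicator measurableSet_Icc,
    setIntegral_const, smul_eq_mul, mul_one]
  calc volume.real (Ioi 0 ∩ Icc R ρ) ≤ volume.real (Icc R ρ) :=
        measureReal_mono inter_subset_right (by simp [Real.volume_Icc])
    _ ≤ ρ := by
        rw [measureReal_def, Real.volume_Icc, ENNReal.toReal_ofReal']
        exact max_le (by linarith) hρ

/-- **The tail integral of the order-`4` weight**: for `0 < r₀`,
`∫ 1_{r₀ ≤ ‖η‖} (1+‖η‖)⁻⁴ dη ≤ 3|B₁| r₀⁻¹` (polar coordinates and `y²(1+y)⁻⁴ ≤ y⁻²`,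
`∫_{r₀}^∞ y⁻² dy = r₀⁻¹`). -/
theorem integral_tail_weight_le {r₀ : ℝ} (hr₀ : 0 < r₀) :
    ∫ η : EuclideanSpace ℝ (Fin 3),
        {η : EuclideanSpace ℝ (Fin 3) | r₀ ≤ ‖η‖}.indicator (fun η => ((1 + ‖η‖) ^ 4)⁻¹) η ≤
      3 * (volume (ball (0 : EuclideanSpace ℝ (Fin 3)) 1)).toReal * r₀⁻¹ := by
  set f : ℝ → ℝ := (Ici r₀).indicator fun y => ((1 + y) ^ 4)⁻¹ with hf
  have hfun : (fun η : EuclideanSpace ℝ (Fin 3) =>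
      {η : EuclideanSpace ℝ (Fin 3) | r₀ ≤ ‖η‖}.indicator (fun η => ((1 + ‖η‖) ^ 4)⁻¹) η) =
      fun η => f ‖η‖ := by
    funext η
    simp only [hf, indicator, mem_setOf_eq, mem_Ici]
  rw [hfun, integral_fun_norm_three f]
  have hvol : 0 ≤ 3 * (volume (ball (0 : EuclideanSpace ℝ (Fin 3)) 1)).toReal := by positivity
  refine mul_le_mul_of_nonneg_left ?_ hvol
  have hpt : ∀ y ∈ Ioi (0 : ℝ), y ^ 2 * f y =
      (Ici r₀).indicator (fun y => y ^ 2 * ((1 + y) ^ 4)⁻¹) y := by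
    intro y _
    simp only [hf, indicator, mem_Ici]
    split_ifs <;> simp
  have hset : Ioi (0 : ℝ) ∩ Ici r₀ = Ici r₀ := by
    ext y
    simp only [mem_inter_iff, mem_Ioi, mem_Ici]
    exact ⟨fun h => h.2, fun h => ⟨hr₀.trans_le h, h⟩⟩
  rw [setIntegral_congr_fun measurableSet_Ioi hpt, setIntegral_indicator measurableSet_Ici, hset,
    setIntegral_congr_set (Ioi_ae_eq_Ici (α := ℝ) (μ := volume)).symm]
  -- compare with `y⁻²` on `(r₀, ∞)`
  have hg : IntegrableOn (fun y : ℝ => y ^ (-2 : ℝ)) (Ioi r₀) :=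
    integrableOn_Ioi_rpow_of_lt (by norm_num) hr₀
  have hval : ∫ y in Ioi r₀, y ^ (-2 : ℝ) = r₀⁻¹ := by
    rw [integral_Ioi_rpow_of_lt (by norm_num) hr₀]
    have : (-2 : ℝ) + 1 = -1 := by norm_num
    rw [this, Real.rpow_neg_one]
    ring
  have hmeas : Measurable fun y : ℝ => y ^ 2 * ((1 + y) ^ 4)⁻¹ :=
    (measurable_id.pow_const 2).mul ((measurable_const.add measurable_id).pow_const 4).inv
  have hptle : ∀ y ∈ Ioi r₀, y ^ 2 * ((1 + y) ^ 4)⁻¹ ≤ y ^ (-2 : ℝ) := by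
    intro y hy
    have hy0 : 0 < y := hr₀.trans hy
    rw [Real.rpow_neg hy0.le, Real.rpow_two]
    calc y ^ 2 * ((1 + y) ^ 4)⁻¹ ≤ y ^ 2 * (y ^ 4)⁻¹ := by
          gcongr
          linarith
      _ = (y ^ 2)⁻¹ := by field_simp
  have hfi : IntegrableOn (fun y : ℝ => y ^ 2 * ((1 + y) ^ 4)⁻¹) (Ioi r₀) := by
    refine hg.mono' hmeas.aestronglyMeasurable ?_
    refine (ae_restrict_iff' measurableSet_Ioi).2 (Filter.Eventually.of_forall fun y hy => ?_)
    rw [Real.norm_of_nonneg (by positivity)]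
    exact hptle y hy
  calc ∫ y in Ioi r₀, y ^ 2 * ((1 + y) ^ 4)⁻¹ ≤ ∫ y in Ioi r₀, y ^ (-2 : ℝ) :=
        setIntegral_mono_on hfi hg measurableSet_Ioi hptle
    _ = r₀⁻¹ := hval

/-! ### Two pointwise facts about frequencies -/

/-- For every splitting `ξ = η + (ξ - η)` one of the two pieces carries half the size of `ξ`. -/
theorem norm_le_two_mul_or (ξ η : EuclideanSpace ℝ (Fin 3)) :
    ‖ξ‖ ≤ 2 * ‖η‖ ∨ ‖ξ‖ ≤ 2 * ‖ξ - η‖ := by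
  have h := norm_le_insert' ξ η
  rcases le_or_gt ‖ξ‖ (2 * ‖η‖) with h1 | h1
  · exact Or.inl h1
  · exact Or.inr (by linarith)

/-- On the region `‖ξ‖ ≤ 2‖η‖` the order-`4` weight at `η` is at most `16` times the weight at `ξ`:
`(1+‖η‖)⁻⁴ ≤ 16 (1+‖ξ‖)⁻⁴`. -/
theorem inv_weight_le_sixteen_mul {ξ η : EuclideanSpace ℝ (Fin 3)} (h : ‖ξ‖ ≤ 2 * ‖η‖) :
    ((1 + ‖η‖) ^ 4)⁻¹ ≤ 16 * ((1 + ‖ξ‖) ^ 4)⁻¹ := by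
  have h1 : 1 + ‖ξ‖ ≤ 2 * (1 + ‖η‖) := by linarith [norm_nonneg η]
  have hpos : 0 < (1 + ‖η‖) ^ 4 := by positivity
  have hposξ : 0 < (1 + ‖ξ‖) ^ 4 := by positivity
  have h4 : (1 + ‖ξ‖) ^ 4 ≤ 16 * (1 + ‖η‖) ^ 4 := by
    calc (1 + ‖ξ‖) ^ 4 ≤ (2 * (1 + ‖η‖)) ^ 4 := pow_le_pow_left₀ (by positivity) h1 4
      _ = 16 * (1 + ‖η‖) ^ 4 := by ring
  rw [inv_le_comm₀ hpos (by positivity), mul_inv, inv_inv]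
  rw [← div_eq_inv_mul, div_le_iff₀ (by norm_num : (0:ℝ) < 16)]
  linarith

/-! ### The convolution at the energy level and the symbol bound -/

/-- **AM–GM bound of the convolution by the energy**: for a coefficient field `v` on `ℝ³` with
`‖v‖²` integrable, `‖(v_j ⋆ v_k)(ξ)‖ ≤ ∫ ‖v(η)‖² dη` for all components `j, k` and all `ξ`
(`|v_j(η)| |v_k(ξ-η)| ≤ (‖v(η)‖² + ‖v(ξ-η)‖²)/2` and translation invariance). -/
theorem norm_fconv_le_integral_norm_sq {v : EuclideanSpace ℝ (Fin 3) → Fin 3 → ℂ}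
    (hv2 : Integrable fun η => ‖v η‖ ^ 2) (j k : Fin 3) (ξ : EuclideanSpace ℝ (Fin 3)) :
    ‖fconv (v · j) (v · k) ξ‖ ≤ ∫ η, ‖v η‖ ^ 2 := by
  have hshift : Integrable fun η => ‖v (ξ - η)‖ ^ 2 := hv2.comp_sub_left ξ
  have hg : Integrable fun η => ‖v η‖ ^ 2 / 2 + ‖v (ξ - η)‖ ^ 2 / 2 :=
    (hv2.div_const 2).add (hshift.div_const 2)
  calc ‖fconv (v · j) (v · k) ξ‖ = ‖∫ η, v η j * v (ξ - η) k‖ := by rw [fconv_apply]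
    _ ≤ ∫ η, ‖v η j * v (ξ - η) k‖ := norm_integral_le_integral_norm _
    _ ≤ ∫ η, (‖v η‖ ^ 2 / 2 + ‖v (ξ - η)‖ ^ 2 / 2) := by
        refine integral_mono_of_nonneg (Filter.Eventually.of_forall fun η => norm_nonneg _) hg
          (Filter.Eventually.of_forall fun η => ?_)
        dsimp only
        rw [norm_mul]
        have ha : ‖v η j‖ ≤ ‖v η‖ := norm_le_pi_norm (v η) j
        have hb : ‖v (ξ - η) k‖ ≤ ‖v (ξ - η)‖ := norm_le_pi_norm (v (ξ - η)) k
        nlinarith [two_mul_le_add_sq ‖v η‖ ‖v (ξ - η)‖, norm_nonneg (v η j),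
          norm_nonneg (v (ξ - η) k), mul_le_mul ha hb (norm_nonneg _) (norm_nonneg _)]
    _ = (∫ η, ‖v η‖ ^ 2) / 2 + (∫ η, ‖v (ξ - η)‖ ^ 2) / 2 := by
        rw [integral_add (hv2.div_const 2) (hshift.div_const 2), integral_div, integral_div]
    _ = ∫ η, ‖v η‖ ^ 2 := by
        rw [integral_sub_left_eq_self (fun η => ‖v η‖ ^ 2) volume ξ]
        ring

/-- **The symbol bound of the nonlinearity**: if all nine convolutions `(v_j ⋆ w_k)(ξ)` are
bounded by `X ≥ 0`, then `‖N(v, w)(ξ)‖ ≤ 36π ‖ξ‖ X` (`|m_{jkl}(ξ)| ≤ 2‖ξ‖`, factor `2π`, nine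
terms; the constant of `FourierNS.norm_nonlin_le_mixed`). -/
theorem norm_nonlin_le_of_fconv_le {v w : EuclideanSpace ℝ (Fin 3) → Fin 3 → ℂ}
    {ξ : EuclideanSpace ℝ (Fin 3)} {X : ℝ} (hX : 0 ≤ X)
    (h : ∀ j k, ‖fconv (v · j) (w · k) ξ‖ ≤ X) :
    ‖nonlin v w ξ‖ ≤ 36 * π * ‖ξ‖ * X := by
  have hterm : ∀ j k l, ‖(lerayDerivSymbol j k l ξ : ℂ) * fconv (v · j) (w · k) ξ‖ ≤
      2 * ‖ξ‖ * X := fun j k l => by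
    rw [norm_mul]
    exact mul_le_mul (norm_ofReal_lerayDerivSymbol_le j k l ξ) (h j k) (norm_nonneg _)
      (by positivity)
  refine (pi_norm_le_iff_of_nonneg (by positivity)).2 fun l => ?_
  rw [nonlin_apply, norm_mul]
  have h2π : ‖-(2 * (π : ℂ) * Complex.I)‖ = 2 * π := by
    simp [Complex.norm_real, Real.norm_eq_abs, abs_of_pos Real.pi_pos]
  rw [h2π]
  calc 2 * π * ‖∑ j, ∑ k, (lerayDerivSymbol j k l ξ : ℂ) * fconv (v · j) (w · k) ξ‖
      ≤ 2 * π * ((Fintype.card (Fin 3) : ℝ) ^ 2 * (2 * ‖ξ‖ * X)) :=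
        mul_le_mul_of_nonneg_left (norm_sum_sum_le fun j k => hterm j k l) (by positivity)
    _ = 36 * π * ‖ξ‖ * X := by simp; ring

end Summit.NavierStokesRegularity.NavierStokesRegularity.Theorems.TightEnvelope

end
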